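import Mathlib
import Summits.Ventures.PercRepro2.HMFRootEdgeNormChordDefs
import Summits.Ventures.PercRepro2.OneEdge

/-!
# The normalised chord across a root edge `{a₃, a₁}`: the root edge is deletable modulo two X-free
rows (blind cell PercRepro2, night-1 g18; NIGHT1-G18.md §2)

With the rows `ρ₀ = rootTangentZero`, `ρ₁ = rootTangentOne` and the cubic identity
`root_chord_identity` of `HMFRootEdgeNormChordDefs`:

* **`prob_PD_update_zero_le_prob_Q_update_one`**: `D⁰ ≤ Z¹` — a configuration of `PD` with `f`
  closed stays in `Q` when `f` is opened (`OneEdge.conn_update_true_iff`), the coupling fact for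
  the degenerate case `Z¹ = 0`;
* **`HMF_of_root_edge_of_normChord`** / **`HMF_of_root_edge_of_tangents`**: the chord condition
  (resp. `0 ≤ ρ₀`, `0 ≤ ρ₁`) and (HMF) without the edge give (HMF) — the right end of the chord is
  the theorem `RootEdge.Phi_nonneg_of_sure`;
* **`HCov_of_root_edge_of_normChord`** / **`HCov_of_root_edge_of_tangents`**: the same for the
  covariance form (`Gc = HMFc + 2 Z D (X̂ − Xexact)`, both `X̂` and `Xexact` affine in `q`).

The `a₂`-edge follows by the root symmetry (`HMFSwap.HMFc_root_swap`, `Gc_swap`), not repeated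
here.  Own code; standard axioms.
-/

namespace Summit.Ventures.PercRepro2

open UnionCluster CovForm

namespace RootEdge

section NormChordThm

variable {V : Type*} {E : Type*} [Fintype E] [DecidableEq E] [Fintype V] [DecidableEq V]
  {R : Type*} [Field R] [LinearOrder R] [IsStrictOrderedRing R]

variable (p : E → R) (ends : E → Sym2 V) (o a₁ a₂ a₃ b : V) {f : E}

variable {a₁ a₂ a₃}

omit [Fintype V] [DecidableEq V] in
/-- **The coupling across a root edge**: a configuration of `PD` with `f = {a₃, a₁}` closed stays in
`Q` when `f` is opened, so `P(PD ; f closed) ≤ P(Q ; f open)`. -/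
lemma prob_PD_update_zero_le_prob_Q_update_one (hp : IsProbVec p) (hf : ends f = s(a₃, a₁)) :
    prob (Function.update p f 0) (PDEvent ends a₁ a₂ a₃) ≤
      prob (Function.update p f 1) (avoidAll ends a₂ {a₁}) := by
  rw [prob_eq_expect_indicator, prob_eq_expect_indicator, expect_update_zero, expect_update_one]
  refine expect_mono hp fun ω => ?_
  by_cases hω : Function.update ω f false ∈ PDEvent ends a₁ a₂ a₃
  · have hQ : Function.update ω f true ∈ avoidAll ends a₂ {a₁} := by
      have hω' := hω
      simp only [PDEvent, Dtilde, UnionCluster.inU, Set.mem_inter_iff, Set.mem_compl_iff,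
        Set.mem_union, mem_connEvent, not_or] at hω'
      obtain ⟨h12, h31, h32⟩ := hω'
      have hup : Function.update ω f true = Function.update (Function.update ω f false) f true := by
        rw [Function.update_idem]
      rw [hup]
      intro x hx
      rw [Finset.mem_singleton] at hx
      subst hx
      rw [OneEdge.conn_update_true_iff hf]
      rintro (h | ⟨h, _⟩ | ⟨h, _⟩)
      · exact h12 (conn_symm h)
      · exact h32 (conn_symm h)
      · exact h12 (conn_symm h)
    simp only [Set.indicator_of_mem hω, Set.indicator_of_mem hQ, Pi.one_apply, le_refl]
  · simp only [Set.indicator_of_notMem hω]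
    exact Set.indicator_nonneg (fun _ _ => zero_le_one) _

/-- **(HMF) across a root edge from the normalised chord**: if
`(1 − q) Z Z¹ · HMFc(p⁰) + q Z Z⁰ · Φ_f(p¹) ≤ Z⁰ Z¹ · Φ_f(p)` and (HMF) holds without the edge,
(HMF) holds. -/
theorem HMF_of_root_edge_of_normChord (hp : IsProbVec p) (hf : ends f = s(a₃, a₁))
    (hchord : (1 - p f) * prob p (avoidAll ends a₂ {a₁}) *
          prob (Function.update p f 1) (avoidAll ends a₂ {a₁}) *
          HMFc (Function.update p f 0) ends o a₁ a₂ a₃ b +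
        p f * prob p (avoidAll ends a₂ {a₁}) *
          prob (Function.update p f 0) (avoidAll ends a₂ {a₁}) *
          Phi (Function.update p f 1) ends o a₁ a₂ a₃ b f ≤
      prob (Function.update p f 0) (avoidAll ends a₂ {a₁}) *
        prob (Function.update p f 1) (avoidAll ends a₂ {a₁}) * Phi p ends o a₁ a₂ a₃ b f)
    (h0 : HMF (Function.update p f 0) ends o a₁ a₂ a₃ b) : HMF p ends o a₁ a₂ a₃ b := by
  have hp0 : IsProbVec (Function.update p f 0) := hp.update f le_rfl zero_le_one
  have hp1 : IsProbVec (Function.update p f 1) := hp.update f zero_le_one le_rfl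
  have hZ0 : 0 ≤ prob (Function.update p f 0) (avoidAll ends a₂ {a₁}) := prob_nonneg hp0 _
  have hZ1 : 0 ≤ prob (Function.update p f 1) (avoidAll ends a₂ {a₁}) := prob_nonneg hp1 _
  have hZ : 0 ≤ prob p (avoidAll ends a₂ {a₁}) := prob_nonneg hp _
  have hq0 := hp.nonneg f
  have hq1 := hp.le_one f
  have hΦ1 : 0 ≤ Phi (Function.update p f 1) ends o a₁ a₂ a₃ b f :=
    Phi_nonneg_of_sure (Function.update p f 1) ends o a₁ a₂ a₃ b hp1 hf (by simp)
  unfold HMF at h0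
  rcases (mul_nonneg hZ0 hZ1).lt_or_eq with hN | hN
  · -- non-degenerate: the chord gives `0 ≤ Φ_f(p)`
    unfold HMF
    rw [HMFc_eq_factor p ends o b hf]
    have h1 : 0 ≤ prob (Function.update p f 0) (avoidAll ends a₂ {a₁}) *
        prob (Function.update p f 1) (avoidAll ends a₂ {a₁}) * Phi p ends o a₁ a₂ a₃ b f := by
      refine le_trans ?_ hchord
      have := mul_nonneg (mul_nonneg (mul_nonneg (by linarith : (0 : R) ≤ 1 - p f) hZ) hZ1) h0
      have := mul_nonneg (mul_nonneg (mul_nonneg hq0 hZ) hZ0) hΦ1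
      linarith
    exact mul_nonneg (by linarith) ((mul_nonneg_iff_of_pos_left hN).1 h1)
  · -- degenerate: `Z⁰ = 0` (then `Z = 0`) or `Z¹ = 0` (then `D⁰ = 0`, hence `D = 0`)
    have hZmono : prob p (avoidAll ends a₂ {a₁}) ≤
        prob (Function.update p f 0) (avoidAll ends a₂ {a₁}) :=
      EdmRow.prob_le_prob_update_zero_of_isLowerSet hp (EdmRow.isLowerSet_avoidAll ends a₁ a₂) f
    have hDmono : prob p (PDEvent ends a₁ a₂ a₃) ≤
        prob (Function.update p f 0) (PDEvent ends a₁ a₂ a₃) :=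
      EdmRow.prob_le_prob_update_zero_of_isLowerSet hp (EdmRow.isLowerSet_PDEvent ends a₁ a₂ a₃) f
    have hcoup := prob_PD_update_zero_le_prob_Q_update_one p ends (a₂ := a₂) hp hf
    have hN' : prob p (avoidAll ends a₂ {a₁}) * prob p (PDEvent ends a₁ a₂ a₃) = 0 := by
      rcases mul_eq_zero.1 hN.symm with hQ | hQ1
      · exact mul_eq_zero_of_left (le_antisymm (hQ ▸ hZmono) hZ) _
      · have hD0 : prob (Function.update p f 0) (PDEvent ends a₁ a₂ a₃) = 0 :=
          le_antisymm (hQ1 ▸ hcoup) (prob_nonneg hp0 _)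
        exact mul_eq_zero_of_right _ (le_antisymm (hD0 ▸ hDmono) (prob_nonneg hp _))
    unfold HMF
    rw [OEdge.HMFc_eq_zero_of_degenerate p ends o a₁ a₂ a₃ b hp hN']

/-- **The root-edge chord from its two tangent rows**: `0 ≤ ρ₀`, `0 ≤ ρ₁` give the chord condition
for every weight `q = p f ∈ [0, 1]`. -/
theorem rootNormChord_of_tangents (hp : IsProbVec p) (hf : ends f = s(a₃, a₁))
    (h0 : 0 ≤ rootTangentZero p ends o a₁ a₂ a₃ b f)
    (h1 : 0 ≤ rootTangentOne p ends o a₁ a₂ a₃ b f) :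
    (1 - p f) * prob p (avoidAll ends a₂ {a₁}) *
          prob (Function.update p f 1) (avoidAll ends a₂ {a₁}) *
          HMFc (Function.update p f 0) ends o a₁ a₂ a₃ b +
        p f * prob p (avoidAll ends a₂ {a₁}) *
          prob (Function.update p f 0) (avoidAll ends a₂ {a₁}) *
          Phi (Function.update p f 1) ends o a₁ a₂ a₃ b f ≤
      prob (Function.update p f 0) (avoidAll ends a₂ {a₁}) *
        prob (Function.update p f 1) (avoidAll ends a₂ {a₁}) * Phi p ends o a₁ a₂ a₃ b f := by
  have hid := root_chord_identity p ends o (a₁ := a₁) (a₂ := a₂) b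
    (by rw [hf]; exact Sym2.mem_mk_left a₃ a₁)
  rw [EdgeChord.Phi_update_zero p ends o a₁ a₂ a₃ b hf] at hid
  have hq0 := hp.nonneg f
  have hq1 := hp.le_one f
  have h2 : 0 ≤ p f * (1 - p f) * ((1 - p f) * rootTangentZero p ends o a₁ a₂ a₃ b f +
      p f * rootTangentOne p ends o a₁ a₂ a₃ b f) :=
    mul_nonneg (mul_nonneg hq0 (by linarith))
      (add_nonneg (mul_nonneg (by linarith) h0) (mul_nonneg hq0 h1))
  linarith

/-- **The root edge is deletable for (HMF) modulo the two tangent rows**: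
`0 ≤ ρ₀ → 0 ≤ ρ₁ → HMF (p[f ↦ 0]) → HMF p` for `f = {a₃, a₁}`. -/
theorem HMF_of_root_edge_of_tangents (hp : IsProbVec p) (hf : ends f = s(a₃, a₁))
    (h0 : 0 ≤ rootTangentZero p ends o a₁ a₂ a₃ b f)
    (h1 : 0 ≤ rootTangentOne p ends o a₁ a₂ a₃ b f)
    (hHMF : HMF (Function.update p f 0) ends o a₁ a₂ a₃ b) : HMF p ends o a₁ a₂ a₃ b :=
  HMF_of_root_edge_of_normChord p ends o b hp hf
    (rootNormChord_of_tangents p ends o b hp hf h0 h1) hHMF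

omit [Fintype V] [DecidableEq V] [LinearOrder R] [IsStrictOrderedRing R] in
/-- The exact `X` pinned along any edge `f`. -/
lemma Xexact_eq_pin (f : E) :
    Xexact p ends o a₁ a₂ a₃ b =
      p f * Xexact (Function.update p f 1) ends o a₁ a₂ a₃ b +
        (1 - p f) * Xexact (Function.update p f 0) ends o a₁ a₂ a₃ b := by
  unfold Xexact deltaL deltaH
  rw [prob_eq_pin p (PDEvent ends a₁ a₂ a₃ ∩ connEvent ends a₁ o ∩ connEvent ends a₂ b) f,
    prob_eq_pin p (PDEvent ends a₁ a₂ a₃ ∩ connEvent ends a₂ o ∩ connEvent ends a₁ b) f,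
    prob_eq_pin p (TEvent ends a₁ a₂ a₃ ∩ connEvent ends a₁ o ∩ connEvent ends a₁ b) f,
    prob_eq_pin p (TEvent ends a₁ a₂ a₃ ∩ connEvent ends a₁ o ∩ connEvent ends a₂ b) f,
    prob_eq_pin p (TEvent ends a₂ a₁ a₃ ∩ connEvent ends a₂ o ∩ connEvent ends a₂ b) f,
    prob_eq_pin p (TEvent ends a₂ a₁ a₃ ∩ connEvent ends a₂ o ∩ connEvent ends a₁ b) f]
  ring

/-- **(HCOV) across a root edge from the normalised chord**: the chord condition (the same
hypothesis as for (HMF)) and (HCOV) without the edge give (HCOV). -/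
theorem HCov_of_root_edge_of_normChord (hp : IsProbVec p) (hf : ends f = s(a₃, a₁))
    (hchord : (1 - p f) * prob p (avoidAll ends a₂ {a₁}) *
          prob (Function.update p f 1) (avoidAll ends a₂ {a₁}) *
          HMFc (Function.update p f 0) ends o a₁ a₂ a₃ b +
        p f * prob p (avoidAll ends a₂ {a₁}) *
          prob (Function.update p f 0) (avoidAll ends a₂ {a₁}) *
          Phi (Function.update p f 1) ends o a₁ a₂ a₃ b f ≤
      prob (Function.update p f 0) (avoidAll ends a₂ {a₁}) *
        prob (Function.update p f 1) (avoidAll ends a₂ {a₁}) * Phi p ends o a₁ a₂ a₃ b f)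
    (h0 : HCov (Function.update p f 0) ends o a₁ a₂ a₃ b) : HCov p ends o a₁ a₂ a₃ b := by
  have hp0 : IsProbVec (Function.update p f 0) := hp.update f le_rfl zero_le_one
  have hp1 : IsProbVec (Function.update p f 1) := hp.update f zero_le_one le_rfl
  have hZ0 : 0 ≤ prob (Function.update p f 0) (avoidAll ends a₂ {a₁}) := prob_nonneg hp0 _
  have hZ1 : 0 ≤ prob (Function.update p f 1) (avoidAll ends a₂ {a₁}) := prob_nonneg hp1 _
  have hZ : 0 ≤ prob p (avoidAll ends a₂ {a₁}) := prob_nonneg hp _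
  have hD0 : 0 ≤ prob (Function.update p f 0) (PDEvent ends a₁ a₂ a₃) := prob_nonneg hp0 _
  have hq0 := hp.nonneg f
  have hq1 := hp.le_one f
  have hΦ1 : 0 ≤ Phi (Function.update p f 1) ends o a₁ a₂ a₃ b f :=
    Phi_nonneg_of_sure (Function.update p f 1) ends o a₁ a₂ a₃ b hp1 hf (by simp)
  have hΔ0 : 0 ≤ Xhat (Function.update p f 0) ends o a₁ a₂ a₃ b -
      Xexact (Function.update p f 0) ends o a₁ a₂ a₃ b := by
    linarith [Xexact_le_Xhat (Function.update p f 0) hp0 ends o a₁ a₂ a₃ b]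
  have hΔ1 : 0 ≤ Xhat (Function.update p f 1) ends o a₁ a₂ a₃ b -
      Xexact (Function.update p f 1) ends o a₁ a₂ a₃ b := by
    linarith [Xexact_le_Xhat (Function.update p f 1) hp1 ends o a₁ a₂ a₃ b]
  unfold HCov at h0 ⊢
  rcases (mul_nonneg hZ0 hZ1).lt_or_eq with hN | hN
  · rw [OEdge.Gc_eq_HMFc_add] at h0 ⊢
    have hD : prob p (PDEvent ends a₁ a₂ a₃) =
        (1 - p f) * prob (Function.update p f 0) (PDEvent ends a₁ a₂ a₃) :=
      prob_eq_of_update_one_eq_zero p _ (by simpa using prob_PD_update_one p ends hf Set.univ)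
    have hX := XhatPin.Xhat_eq_pin p ends o a₁ a₂ a₃ b (by rw [hf]; exact Sym2.mem_mk_left a₃ a₁)
    have hXe := Xexact_eq_pin p ends o (a₁ := a₁) (a₂ := a₂) (a₃ := a₃) b f
    rw [HMFc_eq_factor p ends o b hf, hD, hX, hXe]
    have hA : 0 ≤ prob (Function.update p f 0) (avoidAll ends a₂ {a₁}) *
          prob (Function.update p f 1) (avoidAll ends a₂ {a₁}) * Phi p ends o a₁ a₂ a₃ b f -
        (1 - p f) * prob p (avoidAll ends a₂ {a₁}) *
          prob (Function.update p f 1) (avoidAll ends a₂ {a₁}) *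
          HMFc (Function.update p f 0) ends o a₁ a₂ a₃ b -
        p f * prob p (avoidAll ends a₂ {a₁}) *
          prob (Function.update p f 0) (avoidAll ends a₂ {a₁}) *
          Phi (Function.update p f 1) ends o a₁ a₂ a₃ b f := by linarith
    have hB : 0 ≤ (1 - p f) * prob p (avoidAll ends a₂ {a₁}) *
        prob (Function.update p f 1) (avoidAll ends a₂ {a₁}) *
        (HMFc (Function.update p f 0) ends o a₁ a₂ a₃ b +
          2 * prob (Function.update p f 0) (avoidAll ends a₂ {a₁}) *
            prob (Function.update p f 0) (PDEvent ends a₁ a₂ a₃) *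
            (Xhat (Function.update p f 0) ends o a₁ a₂ a₃ b -
              Xexact (Function.update p f 0) ends o a₁ a₂ a₃ b)) :=
      mul_nonneg (mul_nonneg (mul_nonneg (by linarith) hZ) hZ1) h0
    have hC : 0 ≤ p f * prob p (avoidAll ends a₂ {a₁}) *
        prob (Function.update p f 0) (avoidAll ends a₂ {a₁}) *
        (Phi (Function.update p f 1) ends o a₁ a₂ a₃ b f +
          2 * prob (Function.update p f 1) (avoidAll ends a₂ {a₁}) *
            prob (Function.update p f 0) (PDEvent ends a₁ a₂ a₃) *
            (Xhat (Function.update p f 1) ends o a₁ a₂ a₃ b -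
              Xexact (Function.update p f 1) ends o a₁ a₂ a₃ b)) :=
      mul_nonneg (mul_nonneg (mul_nonneg hq0 hZ) hZ0)
        (add_nonneg hΦ1 (mul_nonneg (mul_nonneg (mul_nonneg (by norm_num) hZ1) hD0) hΔ1))
    have key : 0 ≤ prob (Function.update p f 0) (avoidAll ends a₂ {a₁}) *
        prob (Function.update p f 1) (avoidAll ends a₂ {a₁}) *
        (Phi p ends o a₁ a₂ a₃ b f +
          2 * prob p (avoidAll ends a₂ {a₁}) *
            prob (Function.update p f 0) (PDEvent ends a₁ a₂ a₃) *
            ((p f * Xhat (Function.update p f 1) ends o a₁ a₂ a₃ b +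
                (1 - p f) * Xhat (Function.update p f 0) ends o a₁ a₂ a₃ b) -
              (p f * Xexact (Function.update p f 1) ends o a₁ a₂ a₃ b +
                (1 - p f) * Xexact (Function.update p f 0) ends o a₁ a₂ a₃ b))) := by
      nlinarith [hA, hB, hC]
    have key' := (mul_nonneg_iff_of_pos_left hN).1 key
    nlinarith [key', mul_nonneg (by linarith : (0 : R) ≤ 1 - p f) key']
  · -- degenerate: `Z D = 0` and `Gc = 0`
    have hZmono : prob p (avoidAll ends a₂ {a₁}) ≤
        prob (Function.update p f 0) (avoidAll ends a₂ {a₁}) :=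
      EdmRow.prob_le_prob_update_zero_of_isLowerSet hp (EdmRow.isLowerSet_avoidAll ends a₁ a₂) f
    have hDmono : prob p (PDEvent ends a₁ a₂ a₃) ≤
        prob (Function.update p f 0) (PDEvent ends a₁ a₂ a₃) :=
      EdmRow.prob_le_prob_update_zero_of_isLowerSet hp (EdmRow.isLowerSet_PDEvent ends a₁ a₂ a₃) f
    have hcoup := prob_PD_update_zero_le_prob_Q_update_one p ends (a₂ := a₂) hp hf
    have hN' : prob p (PDEvent ends a₁ a₂ a₃) * prob p (avoidAll ends a₂ {a₁}) = 0 := by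
      rcases mul_eq_zero.1 hN.symm with hQ | hQ1
      · exact mul_eq_zero_of_right _ (le_antisymm (hQ ▸ hZmono) hZ)
      · have hD00 : prob (Function.update p f 0) (PDEvent ends a₁ a₂ a₃) = 0 :=
          le_antisymm (hQ1 ▸ hcoup) hD0
        exact mul_eq_zero_of_left (le_antisymm (hD00 ▸ hDmono) (prob_nonneg hp _)) _
    rw [Chord.Gc_eq_zero_of_degenerate hp ends o a₁ a₂ a₃ b hN']

/-- **The root edge is deletable for (HCOV) modulo the two tangent rows**:
`0 ≤ ρ₀ → 0 ≤ ρ₁ → HCov (p[f ↦ 0]) → HCov p` for `f = {a₃, a₁}`. -/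
theorem HCov_of_root_edge_of_tangents (hp : IsProbVec p) (hf : ends f = s(a₃, a₁))
    (h0 : 0 ≤ rootTangentZero p ends o a₁ a₂ a₃ b f)
    (h1 : 0 ≤ rootTangentOne p ends o a₁ a₂ a₃ b f)
    (hHCov : HCov (Function.update p f 0) ends o a₁ a₂ a₃ b) : HCov p ends o a₁ a₂ a₃ b :=
  HCov_of_root_edge_of_normChord p ends o b hp hf
    (rootNormChord_of_tangents p ends o b hp hf h0 h1) hHCov

end NormChordThm

end RootEdge

end Summit.Ventures.PercRepro2
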